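import Mathlib
import HarnessLib
import Summits.HubbardSuperconductivity.HubbardSuperconductivity.Theorems.KLProgrammeKLRegimeEngineTowerImportBindersWt
import Summits.HubbardSuperconductivity.HubbardSuperconductivity.Theorems.KLProgrammeKLRegimeEngineWtLinesFlowDeepCut

/-!
# Route `KLProgramme` — crux K3 ENGINE (stmt-HubbardSuperconductivity-20437 `KLRegimeEngineV17F2`), ROW (b) binder #5 (E1's (E4) conjunct), cure (α) of located #25
# «(b)-PLAIN-UV-TAIL», LINK 4a: THE WEIGHTED TOWER's FOUR-LEG IMPORTS FROM THE WEIGHTED PLAIN LINE OF THE UV-CUT ELEMENT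
# (cell gate-hubbard-kl, seat hubbard-kl-k3c2-p2 g34; pen (R669)/(R673): cure (α) of record, build authorised, lead k3c2-p2)

Located #25 (✓ p765343 / p765762 / p766222): the PLAIN (`trivialMultiplier`) position-space quartic line of `𝒱_i[K_n]` contains the integer-truncation tail of the
tree's bare vertex (`(|U|/24)·Θ_M`, `Θ_M ≍ (ln M)²`), so E1's (E4) conjunct of row (b) (binder #5: the `klScaleWt_i`-weighted plain four-leg line `≤ s₄·ε_i` for ALL
`M ≥ klEngM₃`) is unsatisfiable as typed.  Cure (α) re-keys every plain four-leg row to the leg-rescaled element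
`S_ĝ T := ExteriorAlgebra.map (LinearMap.mulLeft ℂ ĝ) T`, `ĝ((k,σ),c) = gnScaleCutoff 4 klE0 1 |ω_k|` (one-sector UV cut, `≡ 1` for `|ω| ≤ klE0`), and shows the
consumers lose nothing: the tower reads the plain four-leg rows ONLY through k3c2-p3's weighted aniso-from-plain transfer `klWtPinnedSumAt_le_of_wplain_flow_all`
(✓ `…TowerImportWt`, stated for an ARBITRARY momentum-conserving element), and the weighted sectorised carrier it produces is blind to the cut because the
anisotropic multipliers absorb it (`klbv_klAnisoFamily_mul_uvCut`, ✓ p766263; bridge `klbv_sectorisedKernel_map_mulLeft_of_absorb`, ✓ p765436).  This file is the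
bottom of LINK 4 (binder #5): the `_cut` twins of the four-leg import chain `…TowerImportWt` §3 → `…TowerImportWtArrays` §1/§2 → `…TowerImportRowsWt` →
`…TowerImportBindersWt`, each with the SAME constant and the SAME conclusion, the four-leg plain hypothesis stated for `S_ĝ T` instead of `T`
(the two- and six-leg plain slots of the rows/binders glue are untouched — their outputs are discarded by the assembly of record, (R431)/(R416)):
* §0 `klbv_uvCut_momentumConserving` (the cut element conserves momentum when `T` does), **`klbv_klWtPinnedSumAt_uvCut`** (`klWtPinnedSumAt … (S_ĝ T) = klWtPinnedSumAt … T`);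
* §1 **`klWtPinnedSumAt_four_le_of_wplain_flow_all_cut`** (generic `T`); §2 **`klTowerMeasWtAt_four_le_of_wplain_flow_all_cut`**, **`klWtPinnedSum_four_le_of_wplain_flow_all_cut`**;
* §3 **`importRowsWt_of_wplainLines_flow_all_cut4`**, **`importBindersWt_of_wplainLines_flow_all_cut4`** (faces of ✓ p698372 / ✓ `…ImportBindersWt` verbatim but for the
  four-leg line, proofs token-identical but for the four-leg supplier).
Proofs only; no definitions; the weighted plain lines stay hypotheses (E1's producer targets, now M-uniformly satisfiable); nothing asserts (b), WT4, any stub of 20437,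
K3, U₀, the window or superconductivity.  References: BGM 2006 §2.5 (2.48), §2.7 (2.70)–(2.71a), §2.8 (2.76)–(2.77), (2.96) [cite: BenfattoGiulianiMastropietro2006].
-/

noncomputable section

namespace Summit.HubbardSuperconductivity.HubbardSuperconductivity.Theorems.EngineV8

set_option linter.dupNamespace false -- summit = problem name (single-conjunct summit), D-0017

open Classical
open Real Finset Literature.MathematicalPhysics.QuantumLattice Literature.Probability.LatticeModels GrassmannAlgebra
open Literature.MathematicalPhysics.QuantumLattice.FermiRG
open Summit.HubbardSuperconductivity.HubbardSuperconductivity.Theorems.KLProgrammeLegKernels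
open Summit.HubbardSuperconductivity.HubbardSuperconductivity.Theorems.KLRegimeSplit
open Summit.HubbardSuperconductivity.HubbardSuperconductivity.Theorems.TorusFourierL2
open Summit.HubbardSuperconductivity.HubbardSuperconductivity.Theorems.DispersionFlow
open Summit.HubbardSuperconductivity.HubbardSuperconductivity.Theorems.KLRegimeWick

/-! ## §0 The cut element: momentum conservation and the weighted sectorised carrier -/

/-- **The UV-cut element conserves momentum when `T` does**: `kernel (S_ĝ T) m X = (Π ĝ(X i))·kernel T m X`. -/
theorem klbv_uvCut_momentumConserving {L M : ℕ} [NeZero L] [NeZero M] (β : ℝ) (T : HubbardGrassmann L M)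
    (hT : ∀ (m' : ℕ) (X : Fin m' → HubbardFieldIdx L M), ∑ i, signedMomentum L (X i).2 (X i).1.1.2 ≠ 0 → kernel ℂ T m' X = 0)
    (m' : ℕ) (X : Fin m' → HubbardFieldIdx L M) (hX : ∑ i, signedMomentum L (X i).2 (X i).1.1.2 ≠ 0) :
    kernel ℂ (ExteriorAlgebra.map (LinearMap.mulLeft ℂ (fun K : HubbardFieldIdx L M => ((gnScaleCutoff 4 klE0 1 |matsubaraFreq β M K.1.1.1| : ℝ) : ℂ))) T) m' X = 0 := by
  rw [kernel_map_mulLeft, hT m' X hX, mul_zero]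

/-- **The weighted sectorised carrier is blind to the cut**: `klWtPinnedSumAt … J j m (S_ĝ T) q w = klWtPinnedSumAt … J j m T q w` — the anisotropic multipliers
`F_{J,ω}[K]` absorb `ĝ` (`klbv_klAnisoFamily_mul_uvCut`). [cite: BenfattoGiulianiMastropietro2006, §2.5 (2.48), §2.7 (2.70)-(2.71)] -/
theorem klbv_klWtPinnedSumAt_uvCut {L M : ℕ} [NeZero L] [NeZero M] (β μ : ℝ) (K : TrigPolyC4v) (J j m : ℕ) (T : HubbardGrassmann L M) (q : Fin m)
    (w : SpaceTimeIdx L M × SectorLeg (sectorCount J)) :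
    klWtPinnedSumAt L M β μ K J j m (ExteriorAlgebra.map (LinearMap.mulLeft ℂ (fun K : HubbardFieldIdx L M => ((gnScaleCutoff 4 klE0 1 |matsubaraFreq β M K.1.1.1| : ℝ) : ℂ))) T) q w =
      klWtPinnedSumAt L M β μ K J j m T q w := by
  unfold klWtPinnedSumAt
  refine congrArg (fun t => imagTimeWeight β M ^ (m - 1) * t) (sum_congr rfl fun X _ => ?_)
  rw [kernel_map_sectorAnalysis, kernel_map_sectorAnalysis,
    klbv_sectorisedKernel_map_mulLeft_of_absorb β _ _ (klbv_klAnisoFamily_mul_uvCut β μ K J)]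

/-! ## §1 The weighted four-leg one-anchor size from the weighted plain line of the CUT element (generic `T`) -/

/-- **THE WEIGHTED FOUR-LEG ONE-ANCHOR SIZE FROM THE WEIGHTED PLAIN LINE OF THE CUT ELEMENT** (twin of `klWtPinnedSumAt_four_le_of_wplain_flow_all`, same `CW`):
binders of `…TowerImportWt` §2 at `m + 1 = 4` plus the thin-count doors, `T` momentum-conserving, the `klScaleWt_j`-weighted PLAIN four-leg pinned sums of `S_ĝ T`
(not of `T`) `≤ Sʷ` ⇒ `klWtPinnedSumAt … J j 4 T q (y, ℓ) ≤ klThinCountC·sectorCount J·CW⁴·Sʷ`. [cite: BenfattoGiulianiMastropietro2006, §2.8 (2.76)-(2.77), (2.96)] -/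
theorem klWtPinnedSumAt_four_le_of_wplain_flow_all_cut (R : RenConsts) (c'' : ℝ) (hc'' : 0 ≤ c'') :
    ∃ CW : ℝ, 0 < CW ∧
      ∀ (G : GeoConsts) (P : SplitConsts) (Q : EngConsts) (cc : ℝ), R.WF2 → 0 < cc → cc ≤ klEngC₃6 P R → cc ≤ klThinCountC₃ R →
      ∀ μ ∈ klWindowC, ∀ U : ℝ, 0 < U → U ≤ min (klEngU₀3 P R cc) (1 / (R.Gfr 3 + 1)) → U ≤ klThinCountU₀ R → c'' * U ≤ 1 →
      ∀ β : ℝ, klBetaMin ≤ β → β ≤ Real.exp (cc / U ^ 2) →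
      ∀ (L M : ℕ) [NeZero L] [NeZero M], klEngL₃ β U ≤ L → klEngM₃ β U L ≤ M →
      ∀ n : ℕ, 1 ≤ n → n ≤ nScales β + 1 → IsKLRegime U cc (-(n : ℤ)) → HistP klPredsV17F2 L M G P Q R β U μ 0 n →
        (∀ m', 1 ≤ m' → m' < n → FlowPieceOscAt L M c'' β U μ m') →
        ∀ J j : ℕ, 1 ≤ J → J ≤ n → J ≤ j → ∀ T : HubbardGrassmann L M,
        (∀ (m' : ℕ) (X : Fin m' → HubbardFieldIdx L M), ∑ i, signedMomentum L (X i).2 (X i).1.1.2 ≠ 0 → kernel ℂ T m' X = 0) →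
        ∀ (q : Fin 4) (y : SpaceTimeIdx L M) (ℓ : SectorLeg (sectorCount J)) (Sw : ℝ), 0 ≤ Sw →
        (∀ (τ' : Fin 4 → SectorLeg 1) (y' : SpaceTimeIdx L M),
          imagTimeWeight β M ^ 3 * ∑ x' ∈ univ.filter (fun x' : Fin 4 → SpaceTimeIdx L M => x' q = y'),
            klScaleWt L M β j ((univ.image x').image (fun x : SpaceTimeIdx L M => (((((2 * (x.1 : ℕ) : ℕ)) : ZMod (2 * (2 * M)))), x.2))) *
              ‖sectorisedKernel L M β (trivialMultiplier L M)
                (ExteriorAlgebra.map (LinearMap.mulLeft ℂ (fun K : HubbardFieldIdx L M => ((gnScaleCutoff 4 klE0 1 |matsubaraFreq β M K.1.1.1| : ℝ) : ℂ))) T) 4 τ' x'‖ ≤ Sw) →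
        klWtPinnedSumAt L M β μ (klFlowFrameU L M β U μ n) J j 4 T q (y, ℓ) ≤ klThinCountC * sectorCount J * (CW ^ 4 * Sw) := by
  obtain ⟨CW, hCW, h⟩ := klWtPinnedSumAt_four_le_of_wplain_flow_all R c'' hc''
  refine ⟨CW, hCW, ?_⟩
  intro G P Q cc hR2 hcc hcc6 hccT μ hμ U hU hUle hUT hcU β hβmin hβc L M _ _ hL3 hM3 n hn1 hnN hreg hhist hosc J j hJ1 hJn hJj T hT q y ℓ Sw hSw hplain
  rw [← klbv_klWtPinnedSumAt_uvCut β μ (klFlowFrameU L M β U μ n) J j 4 T q (y, ℓ)]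
  exact h G P Q cc hR2 hcc hcc6 hccT μ hμ U hU hUle hUT hcU β hβmin hβc L M hL3 hM3 n hn1 hnN hreg hhist hosc J j hJ1 hJn hJj _
    (klbv_uvCut_momentumConserving β T hT) q y ℓ Sw hSw hplain

/-! ## §2 The weighted tower's four-leg input size and the `KernelNormsWt4` four-leg carrier -/

/-- **THE WEIGHTED FOUR-LEG INPUT SIZE OF BLOCK `k` FROM THE WEIGHTED PLAIN LINE OF THE CUT INPUT** (twin of `klTowerMeasWtAt_four_le_of_wplain_flow_all`, same
`CW`): `klTowerMeasWtAt L M β U μ K_n d k j 4 ≤ klThinCountC·sectorCount(dk−1)·(CW^4·Sʷ)` whenever every `klScaleWt_j`-weighted PLAIN four-leg pinned sum of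
`S_ĝ 𝒱_{dk}[K_n]` is `≤ Sʷ`. [cite: BenfattoGiulianiMastropietro2006, §2.7 (2.71a), §2.8 (2.76)-(2.77), (2.96)] -/
theorem klTowerMeasWtAt_four_le_of_wplain_flow_all_cut (d : ℕ) (R : RenConsts) (c'' : ℝ) (hc'' : 0 ≤ c'') :
    ∃ CW : ℝ, 0 < CW ∧
      ∀ (G : GeoConsts) (P : SplitConsts) (Q : EngConsts) (cc : ℝ), R.WF2 → 0 < cc → cc ≤ klEngC₃6 P R → cc ≤ klThinCountC₃ R →
      ∀ μ ∈ klWindowC, ∀ U : ℝ, 0 < U → U ≤ min (klEngU₀3 P R cc) (1 / (R.Gfr 3 + 1)) → U ≤ klThinCountU₀ R → c'' * U ≤ 1 →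
      ∀ β : ℝ, klBetaMin ≤ β → β ≤ Real.exp (cc / U ^ 2) →
      ∀ (L M : ℕ) [NeZero L] [NeZero M], klEngL₃ β U ≤ L → klEngM₃ β U L ≤ M →
      ∀ n : ℕ, 1 ≤ n → n ≤ nScales β + 1 → IsKLRegime U cc (-(n : ℤ)) → HistP klPredsV17F2 L M G P Q R β U μ 0 n →
        (∀ m', 1 ≤ m' → m' < n → FlowPieceOscAt L M c'' β U μ m') →
        ∀ k j : ℕ, 1 ≤ d * k - 1 → d * k - 1 ≤ n → d * k - 1 ≤ j → ∀ Sw : ℝ, 0 ≤ Sw →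
        (∀ (q : Fin 4) (τ' : Fin 4 → SectorLeg 1) (y' : SpaceTimeIdx L M),
          imagTimeWeight β M ^ 3 * ∑ x' ∈ univ.filter (fun x' : Fin 4 → SpaceTimeIdx L M => x' q = y'),
            klScaleWt L M β j ((univ.image x').image (fun x : SpaceTimeIdx L M => (((((2 * (x.1 : ℕ) : ℕ)) : ZMod (2 * (2 * M)))), x.2))) *
              ‖sectorisedKernel L M β (trivialMultiplier L M)
                (ExteriorAlgebra.map (LinearMap.mulLeft ℂ (fun K : HubbardFieldIdx L M => ((gnScaleCutoff 4 klE0 1 |matsubaraFreq β M K.1.1.1| : ℝ) : ℂ))) (klTowerInput L M β U μ (klFlowFrameU L M β U μ n) d k)) 4 τ' x'‖ ≤ Sw) →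
        klTowerMeasWtAt L M β U μ (klFlowFrameU L M β U μ n) d k j 4 ≤ (klThinCountC * sectorCount (d * k - 1)) * (CW ^ 4 * Sw) := by
  obtain ⟨CW, hCW, h⟩ := klWtPinnedSumAt_four_le_of_wplain_flow_all_cut R c'' hc''
  refine ⟨CW, hCW, ?_⟩
  intro G P Q cc hR2 hcc hcc6 hccT μ hμ U hU hUle hUT hcU β hβmin hβc L M _ _ hL3 hM3 n hn1 hnN hreg hhist hosc k j hk1 hkn hkj Sw hSw hplain
  have hC := klThinCountC_pos
  have hT : ∀ (m' : ℕ) (X : Fin m' → HubbardFieldIdx L M), ∑ i, signedMomentum L (X i).2 (X i).1.1.2 ≠ 0 →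
      kernel ℂ (klTowerInput L M β U μ (klFlowFrameU L M β U μ n) d k) m' X = 0 :=
    fun m' X hX => klEffectiveAction_momentumConserving β U μ (klFlowFrameU L M β U μ n) klE0 (d * k) m' X hX
  unfold klTowerMeasWtAt
  refine Real.iSup_le (fun qw => ?_) (by positivity)
  obtain ⟨q, y, ℓ⟩ := qw
  exact h G P Q cc hR2 hcc hcc6 hccT μ hμ U hU hUle hUT hcU β hβmin hβc L M hL3 hM3 n hn1 hnN hreg hhist hosc (d * k - 1) j hk1 hkn hkj
    (klTowerInput L M β U μ (klFlowFrameU L M β U μ n) d k) hT q y ℓ Sw hSw (hplain q)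

/-- **THE `KernelNormsWt4` FOUR-LEG CARRIER FROM THE WEIGHTED PLAIN LINE OF THE CUT ELEMENT** (twin of `klWtPinnedSum_four_le_of_wplain_flow_all`, same `CW`;
`T = 𝒱_j[K_n]` at its own family and rate, `1 ≤ j ≤ n`): `klWtPinnedSum L M β U μ K_n j 4 q w ≤ klThinCountC·sectorCount j·(CW^4·Sʷ)` whenever every
`klScaleWt_j`-weighted PLAIN four-leg pinned sum of `S_ĝ 𝒱_j[K_n]` at leg `q` is `≤ Sʷ`. [cite: BenfattoGiulianiMastropietro2006, §2.7 (2.71a), §2.8 (2.76)-(2.77), (2.96)] -/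
theorem klWtPinnedSum_four_le_of_wplain_flow_all_cut (R : RenConsts) (c'' : ℝ) (hc'' : 0 ≤ c'') :
    ∃ CW : ℝ, 0 < CW ∧
      ∀ (G : GeoConsts) (P : SplitConsts) (Q : EngConsts) (cc : ℝ), R.WF2 → 0 < cc → cc ≤ klEngC₃6 P R → cc ≤ klThinCountC₃ R →
      ∀ μ ∈ klWindowC, ∀ U : ℝ, 0 < U → U ≤ min (klEngU₀3 P R cc) (1 / (R.Gfr 3 + 1)) → U ≤ klThinCountU₀ R → c'' * U ≤ 1 →
      ∀ β : ℝ, klBetaMin ≤ β → β ≤ Real.exp (cc / U ^ 2) →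
      ∀ (L M : ℕ) [NeZero L] [NeZero M], klEngL₃ β U ≤ L → klEngM₃ β U L ≤ M →
      ∀ n : ℕ, 1 ≤ n → n ≤ nScales β + 1 → IsKLRegime U cc (-(n : ℤ)) → HistP klPredsV17F2 L M G P Q R β U μ 0 n →
        (∀ m', 1 ≤ m' → m' < n → FlowPieceOscAt L M c'' β U μ m') →
        ∀ j : ℕ, 1 ≤ j → j ≤ n → ∀ (q : Fin 4) (w : SpaceTimeIdx L M × SectorLeg (sectorCount j)) (Sw : ℝ), 0 ≤ Sw →
        (∀ (τ' : Fin 4 → SectorLeg 1) (y' : SpaceTimeIdx L M),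
          imagTimeWeight β M ^ 3 * ∑ x' ∈ univ.filter (fun x' : Fin 4 → SpaceTimeIdx L M => x' q = y'),
            klScaleWt L M β j ((univ.image x').image (fun x : SpaceTimeIdx L M => (((((2 * (x.1 : ℕ) : ℕ)) : ZMod (2 * (2 * M)))), x.2))) *
              ‖sectorisedKernel L M β (trivialMultiplier L M)
                (ExteriorAlgebra.map (LinearMap.mulLeft ℂ (fun K : HubbardFieldIdx L M => ((gnScaleCutoff 4 klE0 1 |matsubaraFreq β M K.1.1.1| : ℝ) : ℂ))) (klEffectiveAction L M β U μ (klFlowFrameU L M β U μ n) klE0 j)) 4 τ' x'‖ ≤ Sw) →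
        klWtPinnedSum L M β U μ (klFlowFrameU L M β U μ n) j 4 q w ≤ (klThinCountC * sectorCount j) * (CW ^ 4 * Sw) := by
  obtain ⟨CW, hCW, h⟩ := klWtPinnedSumAt_four_le_of_wplain_flow_all_cut R c'' hc''
  refine ⟨CW, hCW, ?_⟩
  intro G P Q cc hR2 hcc hcc6 hccT μ hμ U hU hUle hUT hcU β hβmin hβc L M _ _ hL3 hM3 n hn1 hnN hreg hhist hosc j hj1 hjn q w Sw hSw hplain
  have hT : ∀ (m' : ℕ) (X : Fin m' → HubbardFieldIdx L M), ∑ i, signedMomentum L (X i).2 (X i).1.1.2 ≠ 0 →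
      kernel ℂ (klEffectiveAction L M β U μ (klFlowFrameU L M β U μ n) klE0 j) m' X = 0 :=
    fun m' X hX => klEffectiveAction_momentumConserving β U μ (klFlowFrameU L M β U μ n) klE0 j m' X hX
  obtain ⟨y, ℓ⟩ := w
  rw [← klWtPinnedSumOf_klEffectiveAction, ← klWtPinnedSumAt_self]
  exact h G P Q cc hR2 hcc hcc6 hccT μ hμ U hU hUle hUT hcU β hβmin hβc L M hL3 hM3 n hn1 hnN hreg hhist hosc j j hj1 hjn le_rfl
    (klEffectiveAction L M β U μ (klFlowFrameU L M β U μ n) klE0 j) hT q y ℓ Sw hSw hplain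

/-! ## §3 The three weighted import rows / binders, four-leg line CUT -/

set_option maxHeartbeats 400000 in -- three long flow-frame binder lists instantiated side by side (as the uncut original)
/-- **THE THREE WEIGHTED IMPORT ROWS IN FLOOR UNITS AND `(M/β)`-SHAPES FROM WEIGHTED PLAIN LINES, FOUR-LEG LINE CUT** (twin of
`importRowsWt_of_wplainLines_flow_all`, ✓ p698372: same constant, same three conclusions; the four-leg plain hypothesis is stated for `S_ĝ 𝒱_{dk}[K_n]`).
[cite: BenfattoGiulianiMastropietro2006, §2.7 (2.71a), §2.8 (2.76)-(2.77), (2.96)] -/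
theorem importRowsWt_of_wplainLines_flow_all_cut4 (d : ℕ) (R : RenConsts) (c'' : ℝ) (hc'' : 0 ≤ c'') :
    ∃ CW : ℝ, 0 < CW ∧
      ∀ (G : GeoConsts) (P : SplitConsts) (Q : EngConsts) (cc : ℝ), R.WF2 → 0 < cc → cc ≤ klEngC₃6 P R →
      cc ≤ klThinCountC₃ R → cc ≤ klThinCount6C₃ R → cc ≤ klThinCount2C₃ R →
      ∀ μ ∈ klWindowC, ∀ U : ℝ, 0 < U → U ≤ min (klEngU₀3 P R cc) (1 / (R.Gfr 3 + 1)) →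
      U ≤ klThinCountU₀ R → U ≤ klThinCount6U₀ R → U ≤ klThinCount2U₀ R → c'' * U ≤ 1 →
      ∀ β : ℝ, klBetaMin ≤ β → β ≤ Real.exp (cc / U ^ 2) →
      ∀ (L M : ℕ) [NeZero L] [NeZero M], klEngL₃ β U ≤ L → klEngM₃ β U L ≤ M →
      ∀ n : ℕ, 1 ≤ n → n ≤ nScales β + 1 → IsKLRegime U cc (-(n : ℤ)) → HistP klPredsV17F2 L M G P Q R β U μ 0 n →
        (∀ m', 1 ≤ m' → m' < n → FlowPieceOscAt L M c'' β U μ m') →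
      ∀ k j : ℕ, 1 ≤ d * k - 1 → d * k - 1 ≤ n → d * k - 1 ≤ j →
      ∀ (W Z lam s₂ s₄ s₆ : ℝ), 0 ≤ W → 0 ≤ Z → 0 ≤ lam → 0 ≤ s₂ → 0 ≤ s₄ → 0 ≤ s₆ →
        (∀ (q : Fin 2) (τ' : Fin 2 → SectorLeg 1) (y' : SpaceTimeIdx L M),
          imagTimeWeight β M ^ 1 * ∑ x' ∈ univ.filter (fun x' : Fin 2 → SpaceTimeIdx L M => x' q = y'),
            klScaleWt L M β j ((univ.image x').image (fun x : SpaceTimeIdx L M => (((((2 * (x.1 : ℕ) : ℕ)) : ZMod (2 * (2 * M)))), x.2))) *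
              ‖sectorisedKernel L M β (trivialMultiplier L M) (klTowerInput L M β U μ (klFlowFrameU L M β U μ n) d k) 2 τ' x'‖ ≤
            s₂ * ((4 : ℝ) ^ (d * k - 1))⁻¹ * lam) →
        (∀ (q : Fin 4) (τ' : Fin 4 → SectorLeg 1) (y' : SpaceTimeIdx L M),
          imagTimeWeight β M ^ 3 * ∑ x' ∈ univ.filter (fun x' : Fin 4 → SpaceTimeIdx L M => x' q = y'),
            klScaleWt L M β j ((univ.image x').image (fun x : SpaceTimeIdx L M => (((((2 * (x.1 : ℕ) : ℕ)) : ZMod (2 * (2 * M)))), x.2))) *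
              ‖sectorisedKernel L M β (trivialMultiplier L M)
                (ExteriorAlgebra.map (LinearMap.mulLeft ℂ (fun K : HubbardFieldIdx L M => ((gnScaleCutoff 4 klE0 1 |matsubaraFreq β M K.1.1.1| : ℝ) : ℂ))) (klTowerInput L M β U μ (klFlowFrameU L M β U μ n) d k)) 4 τ' x'‖ ≤ s₄ * lam) →
        (∀ (q : Fin 6) (τ' : Fin 6 → SectorLeg 1) (y' : SpaceTimeIdx L M),
          imagTimeWeight β M ^ 5 * ∑ x' ∈ univ.filter (fun x' : Fin 6 → SpaceTimeIdx L M => x' q = y'),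
            klScaleWt L M β j ((univ.image x').image (fun x : SpaceTimeIdx L M => (((((2 * (x.1 : ℕ) : ℕ)) : ZMod (2 * (2 * M)))), x.2))) *
              ‖sectorisedKernel L M β (trivialMultiplier L M) (klTowerInput L M β U μ (klFlowFrameU L M β U μ n) d k) 6 τ' x'‖ ≤ s₆ * lam ^ 2) →
      ∀ (i₁ i₂ x₆ : ℝ), i₁ = 2 * W * Z * klThinCount2C * CW ^ 2 * s₂ → i₂ = 16 * W * Z ^ 2 * klThinCountC * CW ^ 4 * s₄ →
        x₆ = 131072 * W * Z ^ 3 * klThinCount6C * CW ^ 6 * s₆ →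
      W * Z ^ 1 * klTowerMeasWtAt L M β U μ (klFlowFrameU L M β U μ n) d k j 2 / klLevUnitF β M 0 1 (d * k - 1) ≤ (i₁ * ((M : ℝ) / β)) * lam ∧
      W * Z ^ 2 * klTowerMeasWtAt L M β U μ (klFlowFrameU L M β U μ n) d k j 4 / klLevUnitF β M 0 2 (d * k - 1) ≤ (i₂ * ((M : ℝ) / β) ^ 3) * lam ∧
      W * Z ^ 3 * klTowerMeasWtAt L M β U μ (klFlowFrameU L M β U μ n) d k j 6 / klLevUnitF β M 0 3 (d * k - 1) ≤
        (x₆ * ((M : ℝ) / β) ^ 5) * lam ^ 2 := by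
  obtain ⟨CW₁, hCW₁, h1⟩ := klTowerMeasWtAt_two_le_of_wplain_flow_all d R c'' hc''
  obtain ⟨CW₂, hCW₂, h2⟩ := klTowerMeasWtAt_four_le_of_wplain_flow_all_cut d R c'' hc''
  obtain ⟨CW₃, hCW₃, h3⟩ := klTowerMeasWtAt_six_le_of_wplain_flow_all d R c'' hc''
  refine ⟨max CW₁ (max CW₂ CW₃), lt_max_of_lt_left hCW₁, ?_⟩
  intro G P Q cc hR2 hcc hcc6 hccT hccT6 hccT2 μ hμ U hU hUle hUT hUT6 hUT2 hcU β hβmin hβc L M _ _ hL3 hM3 n hn1 hnN hreg hhist hosc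
    k j hk1 hkn hkj W Z lam s₂ s₄ s₆ hW hZ hlam hs₂ hs₄ hs₆ hS₂ hS₄ hS₆ i₁ i₂ x₆ hi₁ hi₂ hx₆
  set CW := max CW₁ (max CW₂ CW₃) with hCWdef
  have hCW1 : CW₁ ≤ CW := le_max_left _ _
  have hCW2 : CW₂ ≤ CW := (le_max_left _ _).trans (le_max_right _ _)
  have hCW3 : CW₃ ≤ CW := (le_max_right _ _).trans (le_max_right _ _)
  have hβ0 : 0 < β := KLRegimeSplit.pos_of_klBetaMin_le hβmin
  have hM0 : (0 : ℝ) < M := Nat.cast_pos.2 (Nat.pos_of_ne_zero (NeZero.ne M))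
  have hε : 0 < imagTimeWeight β M := imagTimeWeight_pos_of_pos (M := M) hβ0
  have hεdef : imagTimeWeight β M = β / (2 * M) := rfl
  have hC2 : 0 ≤ klThinCount2C := klThinCount2C_pos.le
  have hC : 0 ≤ klThinCountC := klThinCountC_pos.le
  have hC6 : 0 ≤ klThinCount6C := klThinCount6C_pos.le
  set J := d * k - 1 with hJ
  set K : TrigPolyC4v := klFlowFrameU L M β U μ n with hKdef
  have h4J : (0 : ℝ) < (4 : ℝ) ^ J := by positivity
  have h2J : (0 : ℝ) < (2 : ℝ) ^ J := by positivity
  have hsc : (sectorCount J : ℝ) = 2 * (2 : ℝ) ^ J := by simp [sectorCount, pow_succ, mul_comm]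
  -- the currency: `(M/β)·ε_x = 1/2`
  have hr : ((M : ℝ) / β) * imagTimeWeight β M = 1 / 2 := by
    rw [hεdef, div_mul_div_comm, div_eq_div_iff (by positivity) (by norm_num)]
    ring
  have hr3 : ((M : ℝ) / β) ^ 3 * imagTimeWeight β M ^ 3 = 1 / 8 := by rw [← mul_pow, hr]; norm_num
  have hr5 : ((M : ℝ) / β) ^ 5 * imagTimeWeight β M ^ 5 = 1 / 32 := by rw [← mul_pow, hr]; norm_num
  have hcard : (Fintype.card (SectorLeg (sectorCount J)) : ℝ) ^ 4 = 4096 * (2 : ℝ) ^ (4 * J) := by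
    rw [card_sectorLeg_sectorCount, mul_pow, ← pow_mul, mul_comm J 4]; norm_num
  refine ⟨?_, ?_, ?_⟩
  · -- two legs: unit `ε_x/4^J`, count `klThinCount2C`
    have hS0 : 0 ≤ s₂ * ((4 : ℝ) ^ J)⁻¹ * lam := by positivity
    have hA := h1 G P Q cc hR2 hcc hcc6 hccT2 μ hμ U hU hUle hUT2 hcU β hβmin hβc L M hL3 hM3 n hn1 hnN hreg hhist hosc k j hk1 hkn hkj _ hS0 hS₂
    have hpow : CW₁ ^ 2 ≤ CW ^ 2 := pow_le_pow_left₀ hCW₁.le hCW1 2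
    have hu : 0 < klLevUnitF β M 0 1 J := klLevUnitF_pos hβ0 0 1 J
    rw [div_le_iff₀ hu, klLevUnitF_one_eq_of_gain_zero β M (show klLevGain (0 : Fin 5) = 0 from rfl) J]
    calc W * Z ^ 1 * klTowerMeasWtAt L M β U μ K d k j 2 ≤ W * Z ^ 1 * (klThinCount2C * (CW₁ ^ 2 * (s₂ * ((4 : ℝ) ^ J)⁻¹ * lam))) :=
          mul_le_mul_of_nonneg_left hA (by positivity)
      _ ≤ W * Z ^ 1 * (klThinCount2C * (CW ^ 2 * (s₂ * ((4 : ℝ) ^ J)⁻¹ * lam))) := by gcongr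
      _ = (i₁ * ((M : ℝ) / β)) * lam * (imagTimeWeight β M / (4 : ℝ) ^ J) := by
          subst hi₁
          linear_combination (-(2 * W * Z * klThinCount2C * CW ^ 2 * s₂ * lam * ((4 : ℝ) ^ J)⁻¹)) * hr
  · -- four legs: unit `ε_x³·2^J`, count `klThinCountC·sectorCount J`
    have hS0 : 0 ≤ s₄ * lam := by positivity
    have hA := h2 G P Q cc hR2 hcc hcc6 hccT μ hμ U hU hUle hUT hcU β hβmin hβc L M hL3 hM3 n hn1 hnN hreg hhist hosc k j hk1 hkn hkj _ hS0 hS₄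
    rw [hsc] at hA
    have hpow : CW₂ ^ 4 ≤ CW ^ 4 := pow_le_pow_left₀ hCW₂.le hCW2 4
    have hu : 0 < klLevUnitF β M 0 2 J := klLevUnitF_pos hβ0 0 2 J
    have hu2 : klLevUnitF β M 0 2 J = imagTimeWeight β M ^ 3 * (2 : ℝ) ^ J := by
      rw [klLevUnitF_two_eq, show klLevGain (0 : Fin 5) * J = 0 by rw [show klLevGain (0 : Fin 5) = 0 from rfl, zero_mul], pow_zero, div_one]
    rw [div_le_iff₀ hu, hu2]
    calc W * Z ^ 2 * klTowerMeasWtAt L M β U μ K d k j 4 ≤ W * Z ^ 2 * (klThinCountC * (2 * (2 : ℝ) ^ J) * (CW₂ ^ 4 * (s₄ * lam))) :=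
          mul_le_mul_of_nonneg_left hA (by positivity)
      _ ≤ W * Z ^ 2 * (klThinCountC * (2 * (2 : ℝ) ^ J) * (CW ^ 4 * (s₄ * lam))) := by gcongr
      _ = (i₂ * ((M : ℝ) / β) ^ 3) * lam * (imagTimeWeight β M ^ 3 * (2 : ℝ) ^ J) := by
          subst hi₂
          linear_combination (-(16 * (2 : ℝ) ^ J * W * Z ^ 2 * klThinCountC * CW ^ 4 * s₄ * lam)) * hr3
  · -- six legs: unit `ε_x⁵·2^{4J}`, count `klThinCount6C·|SectorLeg|⁴`
    have hS0 : 0 ≤ s₆ * lam ^ 2 := by positivity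
    have hA := h3 G P Q cc hR2 hcc hcc6 hccT6 μ hμ U hU hUle hUT6 hcU β hβmin hβc L M hL3 hM3 n hn1 hnN hreg hhist hosc k j hk1 hkn hkj _ hS0 hS₆
    rw [hcard] at hA
    have hpow : CW₃ ^ 6 ≤ CW ^ 6 := pow_le_pow_left₀ hCW₃.le hCW3 6
    have hu : 0 < klLevUnitF β M 0 3 J := klLevUnitF_pos hβ0 0 3 J
    have h24J : (0 : ℝ) < (2 : ℝ) ^ (4 * J) := by positivity
    rw [div_le_iff₀ hu, klLevUnitF_zero_three_eq]
    calc W * Z ^ 3 * klTowerMeasWtAt L M β U μ K d k j 6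
        ≤ W * Z ^ 3 * (klThinCount6C * (4096 * (2 : ℝ) ^ (4 * J)) * (CW₃ ^ 6 * (s₆ * lam ^ 2))) :=
          mul_le_mul_of_nonneg_left hA (by positivity)
      _ ≤ W * Z ^ 3 * (klThinCount6C * (4096 * (2 : ℝ) ^ (4 * J)) * (CW ^ 6 * (s₆ * lam ^ 2))) := by gcongr
      _ = (x₆ * ((M : ℝ) / β) ^ 5) * lam ^ 2 * (imagTimeWeight β M ^ 5 * (2 : ℝ) ^ (4 * J)) := by
          subst hx₆
          linear_combination (-(131072 * (2 : ℝ) ^ (4 * J) * W * Z ^ 3 * klThinCount6C * CW ^ 6 * s₆ * lam ^ 2)) * hr5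

/-- **THE THREE WEIGHTED IMPORT BINDERS OF `klTowerBornWtAt_le_law_of_blocks_klEng_tokX` FROM WEIGHTED PLAIN LINES, FOUR-LEG LINE CUT** (twin of
`importBindersWt_of_wplainLines_flow_all`: same constant, same three binder families; the four-leg plain hypothesis is stated for `S_ĝ 𝒱_{dk}[K_n]`).
[cite: BenfattoGiulianiMastropietro2006, §2.7 (2.71a), §2.8 (2.76)-(2.77), (2.96)] -/
theorem importBindersWt_of_wplainLines_flow_all_cut4 (d : ℕ) (R : RenConsts) (c'' : ℝ) (hc'' : 0 ≤ c'') :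
    ∃ CW : ℝ, 0 < CW ∧
      ∀ (G : GeoConsts) (P : SplitConsts) (Q : EngConsts) (cc : ℝ), R.WF2 → 0 < cc → cc ≤ klEngC₃6 P R →
      cc ≤ klThinCountC₃ R → cc ≤ klThinCount6C₃ R → cc ≤ klThinCount2C₃ R →
      ∀ μ ∈ klWindowC, ∀ U : ℝ, 0 < U → U ≤ min (klEngU₀3 P R cc) (1 / (R.Gfr 3 + 1)) →
      U ≤ klThinCountU₀ R → U ≤ klThinCount6U₀ R → U ≤ klThinCount2U₀ R → c'' * U ≤ 1 →
      ∀ β : ℝ, klBetaMin ≤ β → β ≤ Real.exp (cc / U ^ 2) →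
      ∀ (L M : ℕ) [NeZero L] [NeZero M], klEngL₃ β U ≤ L → klEngM₃ β U L ≤ M →
      ∀ n : ℕ, 1 ≤ n → n ≤ nScales β + 1 → IsKLRegime U cc (-(n : ℤ)) → HistP klPredsV17F2 L M G P Q R β U μ 0 n →
        (∀ m', 1 ≤ m' → m' < n → FlowPieceOscAt L M c'' β U μ m') →
      2 ≤ d → ∀ Kb j : ℕ, 1 ≤ Kb → d * Kb ≤ j → j ≤ n →
      ∀ (W Z lam s₂ s₄ s₆ : ℝ), 0 ≤ W → 0 ≤ Z → 0 ≤ lam → 0 ≤ s₂ → 0 ≤ s₄ → 0 ≤ s₆ →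
        (∀ k, 1 ≤ k → k ≤ Kb → ∀ (q : Fin 2) (τ' : Fin 2 → SectorLeg 1) (y' : SpaceTimeIdx L M),
          imagTimeWeight β M ^ 1 * ∑ x' ∈ univ.filter (fun x' : Fin 2 → SpaceTimeIdx L M => x' q = y'),
            klScaleWt L M β j ((univ.image x').image (fun x : SpaceTimeIdx L M => (((((2 * (x.1 : ℕ) : ℕ)) : ZMod (2 * (2 * M)))), x.2))) *
              ‖sectorisedKernel L M β (trivialMultiplier L M) (klTowerInput L M β U μ (klFlowFrameU L M β U μ n) d k) 2 τ' x'‖ ≤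
            s₂ * ((4 : ℝ) ^ (d * k - 1))⁻¹ * lam) →
        (∀ k, 1 ≤ k → k ≤ Kb → ∀ (q : Fin 4) (τ' : Fin 4 → SectorLeg 1) (y' : SpaceTimeIdx L M),
          imagTimeWeight β M ^ 3 * ∑ x' ∈ univ.filter (fun x' : Fin 4 → SpaceTimeIdx L M => x' q = y'),
            klScaleWt L M β j ((univ.image x').image (fun x : SpaceTimeIdx L M => (((((2 * (x.1 : ℕ) : ℕ)) : ZMod (2 * (2 * M)))), x.2))) *
              ‖sectorisedKernel L M β (trivialMultiplier L M)
                (ExteriorAlgebra.map (LinearMap.mulLeft ℂ (fun K : HubbardFieldIdx L M => ((gnScaleCutoff 4 klE0 1 |matsubaraFreq β M K.1.1.1| : ℝ) : ℂ))) (klTowerInput L M β U μ (klFlowFrameU L M β U μ n) d k)) 4 τ' x'‖ ≤ s₄ * lam) →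
        (∀ k, 1 ≤ k → k ≤ Kb → ∀ (q : Fin 6) (τ' : Fin 6 → SectorLeg 1) (y' : SpaceTimeIdx L M),
          imagTimeWeight β M ^ 5 * ∑ x' ∈ univ.filter (fun x' : Fin 6 → SpaceTimeIdx L M => x' q = y'),
            klScaleWt L M β j ((univ.image x').image (fun x : SpaceTimeIdx L M => (((((2 * (x.1 : ℕ) : ℕ)) : ZMod (2 * (2 * M)))), x.2))) *
              ‖sectorisedKernel L M β (trivialMultiplier L M) (klTowerInput L M β U μ (klFlowFrameU L M β U μ n) d k) 6 τ' x'‖ ≤ s₆ * lam ^ 2) →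
      ∀ (i₁ i₂ x₆ : ℝ), i₁ = 2 * W * Z * klThinCount2C * CW ^ 2 * s₂ → i₂ = 16 * W * Z ^ 2 * klThinCountC * CW ^ 4 * s₄ →
        x₆ = 131072 * W * Z ^ 3 * klThinCount6C * CW ^ 6 * s₆ →
      (∀ k, 1 ≤ k → k ≤ Kb → W * Z ^ 1 *
        (klTowerMeasWtAt L M β U μ (klFlowFrameU L M β U μ n) d k j (2 * 1) / klLevUnitF β M 0 1 (d * k - 1)) ≤ (i₁ * ((M : ℝ) / β)) * lam) ∧
      (∀ k, 1 ≤ k → k ≤ Kb → W * Z ^ 2 *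
        (klTowerMeasWtAt L M β U μ (klFlowFrameU L M β U μ n) d k j (2 * 2) / klLevUnitF β M 0 2 (d * k - 1)) ≤ (i₂ * ((M : ℝ) / β) ^ 3) * lam) ∧
      (∀ k, 1 ≤ k → k ≤ Kb → W * Z ^ 3 *
        (klTowerMeasWtAt L M β U μ (klFlowFrameU L M β U μ n) d k j (2 * 3) / klLevUnitF β M 0 3 (d * k - 1)) ≤ (x₆ * ((M : ℝ) / β) ^ 5) * lam ^ 2) := by
  obtain ⟨CW, hCW, h⟩ := importRowsWt_of_wplainLines_flow_all_cut4 d R c'' hc''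
  refine ⟨CW, hCW, ?_⟩
  intro G P Q cc hR2 hcc hcc6 hccT hccT6 hccT2 μ hμ U hU hUle hUT hUT6 hUT2 hcU β hβmin hβc L M _ _ hL3 hM3 n hn1 hnN hreg hhist hosc
    hd Kb j hKb hKbj hjn W Z lam s₂ s₄ s₆ hW hZ hlam hs₂ hs₄ hs₆ hS₂ hS₄ hS₆ i₁ i₂ x₆ hi₁ hi₂ hx₆
  have hrow : ∀ k, 1 ≤ k → k ≤ Kb →
      W * Z ^ 1 * klTowerMeasWtAt L M β U μ (klFlowFrameU L M β U μ n) d k j 2 / klLevUnitF β M 0 1 (d * k - 1) ≤ (i₁ * ((M : ℝ) / β)) * lam ∧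
      W * Z ^ 2 * klTowerMeasWtAt L M β U μ (klFlowFrameU L M β U μ n) d k j 4 / klLevUnitF β M 0 2 (d * k - 1) ≤ (i₂ * ((M : ℝ) / β) ^ 3) * lam ∧
      W * Z ^ 3 * klTowerMeasWtAt L M β U μ (klFlowFrameU L M β U μ n) d k j 6 / klLevUnitF β M 0 3 (d * k - 1) ≤
        (x₆ * ((M : ℝ) / β) ^ 5) * lam ^ 2 := by
    intro k hk hkK
    have hdk : d * k ≤ d * Kb := Nat.mul_le_mul_left d hkK
    have hdk2 : 2 ≤ d * k := le_trans hd (Nat.le_mul_of_pos_right d hk)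
    exact h G P Q cc hR2 hcc hcc6 hccT hccT6 hccT2 μ hμ U hU hUle hUT hUT6 hUT2 hcU β hβmin hβc L M hL3 hM3 n hn1 hnN hreg hhist hosc
      k j (by omega) (by omega) (by omega) W Z lam s₂ s₄ s₆ hW hZ hlam hs₂ hs₄ hs₆ (hS₂ k hk hkK) (hS₄ k hk hkK) (hS₆ k hk hkK) i₁ i₂ x₆ hi₁ hi₂ hx₆
  refine ⟨fun k hk hkK => ?_, fun k hk hkK => ?_, fun k hk hkK => ?_⟩
  · rw [← mul_div_assoc]; exact (hrow k hk hkK).1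
  · rw [← mul_div_assoc]; exact (hrow k hk hkK).2.1
  · rw [← mul_div_assoc]; exact (hrow k hk hkK).2.2

end Summit.HubbardSuperconductivity.HubbardSuperconductivity.Theorems.EngineV8

end
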